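import Summits.HubbardSuperconductivity.HubbardSuperconductivity.Theorems.JosephsonMirrorJmInterchangeWindowPigeonhole
import Summits.HubbardSuperconductivity.HubbardSuperconductivity.Theorems.JosephsonMirrorJmInterchangeCouplingBound

/-!
# Route `JosephsonMirror` — crux `JmInterchange` (stmt-HubbardSuperconductivity-2227), line `Sketch`:
# the Josephson coupling of a near-floor window state is carried by the floors (abstract `W`-matrix estimate)

Helper file (lead c2) for the RATE FORM of the interchange.  Setting: Lieb's packaging `ψ_W (s,t) = W s t`
of a Hermitian window matrix `W` (unit vector, supported on pairs in a common block `P₁` or `P₂`), a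
Hermitian one-layer operator `A` with `A ≥ e₀` on block-supported vectors, the Josephson coupling
`K = D ⊗ D̄ + Dᴴ ⊗ D̄ᴴ` (`D̄ = Dᴴᵀ`) with the one-layer bounds `‖D v‖², ‖Dᴴ v‖² ≤ M ‖v‖²`, and a Hermitian
contraction `P` (in the application: the orthogonal projection onto the two sector ground floors) such that

* (gap, variance form) `γ ‖(1 - P) v‖² ≤ Re ⟨v, A v⟩ - e₀ ‖v‖²` for every block-supported `v`;
* (floor-to-floor transfer) `‖P D P v‖² ≤ s₁ ‖v‖²`, `‖P Dᴴ P v‖² ≤ s₂ ‖v‖²`.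

Then (`re_coupling_le_floor_add_leak`) a window state of `A ⊗ 1 + 1 ⊗ Aᵀ`-energy `≤ 2 e₀ + η` has
`Re ⟨ψ_W, K ψ_W⟩ ≤ s₁ + s₂ + 2 M l + (2 M l⁻¹ + 2 M) (2 η / γ)` for every `l > 0`: write `W = P W P + R`;
the floor part contributes `Tr (W (PDP) W (PDP)ᴴ) + h.c. ≤ s₁ + s₂` (Hilbert–Schmidt Cauchy–Schwarz), the
three remainder terms are `O(M ‖R‖_HS)` and `‖R‖²_HS ≤ 4 ‖(1-P) W‖²_HS ≤ 2 η / γ` by the gap, column by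
column (`Re ⟨ψ_W, (A ⊗ 1 + 1 ⊗ Aᵀ) ψ_W⟩ = 2 Σ_t Re ⟨w_t, A w_t⟩`).  This is first-order degenerate
perturbation theory for the window double with the error made quantitative in the `W`-matrix language;
it is the engine of `Theorems/JosephsonMirrorJmInterchangeRateForm.lean`.

Sources: E. H. Lieb, Phys. Rev. Lett. 62 (1989) 1201 (the `W`-matrix packaging, eq. (4)); T. Koma,
H. Tasaki, J. Stat. Phys. 76 (1994) 745 (first-order response of a degenerate floor to an order-parameter
coupling); T. Kato, *Perturbation Theory for Linear Operators* (1966) II §5 (degenerate first-order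
perturbation theory).  All statements are folklore finite-dimensional linear algebra.  No new definitions.
-/

-- the mandated namespace `Summit.<Summit>.<Problem>.Theorems` repeats `HubbardSuperconductivity`
-- (single-problem summit, D-0017), which the `dupNamespace` linter flags on every declaration
set_option linter.dupNamespace false

namespace Summit.HubbardSuperconductivity.HubbardSuperconductivity.Theorems.JosephsonMirror

open Matrix Literature.MathematicalPhysics.QuantumLattice
open scoped Kronecker ComplexOrder

section HilbertSchmidt

variable {ι : Type*} [Fintype ι]

/-- Two-sided Hilbert–Schmidt AM–GM: `2 |Re ⟨X, Y⟩_HS| ≤ l ‖X‖²_HS + l⁻¹ ‖Y‖²_HS` for `l > 0`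
(`two_mul_re_hsInner_le` for `Y` and `-Y`). [folklore] -/
theorem two_mul_abs_re_hsInner_le (X Y : Matrix ι ι ℂ) {l : ℝ} (hl : 0 < l) :
    2 * |(hsInner X Y).re| ≤ l * (hsInner X X).re + l⁻¹ * (hsInner Y Y).re := by
  have h1 := two_mul_re_hsInner_le X Y hl
  have h2 := two_mul_re_hsInner_le X (-Y) hl
  have hneg : hsInner X (-Y) = -hsInner X Y := by
    rw [← neg_one_smul ℂ Y, hsInner_smul_right, neg_one_mul]
  have hnn : hsInner (-Y) (-Y) = hsInner Y Y := by
    simp [hsInner]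
  rw [hneg, hnn, Complex.neg_re] at h2
  rcases le_or_gt 0 (hsInner X Y).re with h | h
  · rw [abs_of_nonneg h]
    exact h1
  · rw [abs_of_neg h]
    linarith

/-- `⟨X, D Y Dᴴ⟩_HS = ⟨Dᴴ X, Y Dᴴ⟩_HS` (`Tr (Xᴴ D Y Dᴴ)` both ways). [folklore] -/
theorem hsInner_sandwich_eq (X Y D : Matrix ι ι ℂ) :
    hsInner X (D * Y * Dᴴ) = hsInner (Dᴴ * X) (Y * Dᴴ) := by
  simp only [hsInner, conjTranspose_mul, conjTranspose_conjTranspose, Matrix.mul_assoc]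

/-- The row estimate: if `‖D v‖² ≤ M ‖v‖²` for all `v`, then `‖Y Dᴴ‖²_HS ≤ M ‖Y‖²_HS`
(`‖Y Dᴴ‖_HS = ‖D Yᴴ‖_HS`, the column estimate, `‖Yᴴ‖_HS = ‖Y‖_HS`). [folklore] -/
theorem re_hsInner_mul_conjTranspose_self_le (D Y : Matrix ι ι ℂ) {M : ℝ}
    (hD : ∀ v : ι → ℂ, (star (D *ᵥ v) ⬝ᵥ (D *ᵥ v)).re ≤ M * (star v ⬝ᵥ v).re) :
    (hsInner (Y * Dᴴ) (Y * Dᴴ)).re ≤ M * (hsInner Y Y).re := by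
  rw [hsInner_mul_self_eq_conjTranspose, conjTranspose_conjTranspose, ← hsInner_conjTranspose_self Y]
  exact re_hsInner_mul_self_le D Yᴴ hD

/-- **Remainder estimate.** `2 |Re ⟨X, D Y Dᴴ⟩_HS| ≤ M (l ‖X‖²_HS + l⁻¹ ‖Y‖²_HS)` for `l > 0`, from the
one-layer bounds `‖D v‖², ‖Dᴴ v‖² ≤ M ‖v‖²`. [folklore] -/
theorem two_mul_abs_re_hsInner_sandwich_le (X Y D : Matrix ι ι ℂ) {M l : ℝ} (hl : 0 < l)
    (hD : ∀ v : ι → ℂ, (star (D *ᵥ v) ⬝ᵥ (D *ᵥ v)).re ≤ M * (star v ⬝ᵥ v).re)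
    (hDh : ∀ v : ι → ℂ, (star (Dᴴ *ᵥ v) ⬝ᵥ (Dᴴ *ᵥ v)).re ≤ M * (star v ⬝ᵥ v).re) :
    2 * |(hsInner X (D * Y * Dᴴ)).re| ≤ M * (l * (hsInner X X).re + l⁻¹ * (hsInner Y Y).re) := by
  rw [hsInner_sandwich_eq]
  have h := two_mul_abs_re_hsInner_le (Dᴴ * X) (Y * Dᴴ) hl
  have h1 : (hsInner (Dᴴ * X) (Dᴴ * X)).re ≤ M * (hsInner X X).re := re_hsInner_mul_self_le _ _ hDh
  have h2 : (hsInner (Y * Dᴴ) (Y * Dᴴ)).re ≤ M * (hsInner Y Y).re :=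
    re_hsInner_mul_conjTranspose_self_le D Y hD
  have h1' := mul_le_mul_of_nonneg_left h1 hl.le
  have h2' := mul_le_mul_of_nonneg_left h2 (inv_pos.2 hl).le
  nlinarith

/-- Bilinear expansion of the sandwich form along `W = Y + R`. [folklore] -/
theorem hsInner_sandwich_add_add (Y R D : Matrix ι ι ℂ) :
    hsInner (Y + R) (D * (Y + R) * Dᴴ) =
      hsInner Y (D * Y * Dᴴ) + hsInner Y (D * R * Dᴴ) + hsInner R (D * Y * Dᴴ) +
        hsInner R (D * R * Dᴴ) := by
  simp only [Matrix.mul_add, Matrix.add_mul, hsInner_add_left, hsInner_add_right]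
  ring

/-- `‖X + Y‖²_HS ≤ 2 ‖X‖²_HS + 2 ‖Y‖²_HS`. [folklore] -/
theorem re_hsInner_add_self_le (X Y : Matrix ι ι ℂ) :
    (hsInner (X + Y) (X + Y)).re ≤ 2 * (hsInner X X).re + 2 * (hsInner Y Y).re := by
  have h := two_mul_re_hsInner_le X Y one_pos
  rw [inv_one, one_mul, one_mul] at h
  have hYX : (hsInner Y X).re = (hsInner X Y).re := by
    rw [← star_hsInner X Y, Complex.star_def, Complex.conj_re]
  simp only [hsInner_add_left, hsInner_add_right, Complex.add_re, hYX]
  linarith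

/-- **The floor part of the coupling.** For Hermitian `P`, `W`:
`⟨P W P, D (P W P) Dᴴ⟩_HS = ⟨W, (P D P) W (P D P)ᴴ⟩_HS` (cyclicity of the trace). [folklore] -/
theorem hsInner_floor_sandwich_eq {P W : Matrix ι ι ℂ} (hP : Pᴴ = P) (hW : Wᴴ = W) (D : Matrix ι ι ℂ) :
    hsInner (P * W * P) (D * (P * W * P) * Dᴴ) = hsInner W ((P * D * P) * W * (P * D * P)ᴴ) := by
  simp only [hsInner, conjTranspose_mul, hP, hW, Matrix.mul_assoc]
  rw [trace_mul_comm]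
  simp only [Matrix.mul_assoc]

/-- **Floor-to-floor Cauchy–Schwarz.** For Hermitian `W` and any `X` with `‖X v‖² ≤ s₁ ‖v‖²`,
`‖Xᴴ v‖² ≤ s₂ ‖v‖²`: `2 Re ⟨W, X W Xᴴ⟩_HS ≤ (s₁ + s₂) ‖W‖²_HS`
(`⟨W, X W Xᴴ⟩ = ⟨Xᴴ W, W Xᴴ⟩`, AM–GM, `‖W Xᴴ‖_HS = ‖X W‖_HS`). [folklore] -/
theorem two_mul_re_hsInner_conj_le {W : Matrix ι ι ℂ} (hW : Wᴴ = W) (X : Matrix ι ι ℂ) {s₁ s₂ : ℝ}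
    (hX : ∀ v : ι → ℂ, (star (X *ᵥ v) ⬝ᵥ (X *ᵥ v)).re ≤ s₁ * (star v ⬝ᵥ v).re)
    (hXh : ∀ v : ι → ℂ, (star (Xᴴ *ᵥ v) ⬝ᵥ (Xᴴ *ᵥ v)).re ≤ s₂ * (star v ⬝ᵥ v).re) :
    2 * (hsInner W (X * W * Xᴴ)).re ≤ (s₁ + s₂) * (hsInner W W).re := by
  rw [hsInner_conj_eq]
  have h := two_mul_re_hsInner_le (Xᴴ * W) (W * Xᴴ) one_pos
  rw [inv_one, one_mul, one_mul, hsInner_mul_conjTranspose_self hW] at h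
  have h1 : (hsInner (Xᴴ * W) (Xᴴ * W)).re ≤ s₂ * (hsInner W W).re := re_hsInner_mul_self_le _ _ hXh
  have h2 : (hsInner (X * W) (X * W)).re ≤ s₁ * (hsInner W W).re := re_hsInner_mul_self_le _ _ hX
  linarith

/-- For a Hermitian contraction `P` and Hermitian `W`: `‖P W P‖²_HS ≤ ‖W‖²_HS`. [folklore] -/
theorem re_hsInner_floor_self_le {P W : Matrix ι ι ℂ} (hP : Pᴴ = P) (hW : Wᴴ = W)
    (hPc : ∀ v : ι → ℂ, (star (P *ᵥ v) ⬝ᵥ (P *ᵥ v)).re ≤ (star v ⬝ᵥ v).re) :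
    (hsInner (P * W * P) (P * W * P)).re ≤ (hsInner W W).re := by
  have hPc' : ∀ v : ι → ℂ, (star (P *ᵥ v) ⬝ᵥ (P *ᵥ v)).re ≤ 1 * (star v ⬝ᵥ v).re := fun v => by
    rw [one_mul]; exact hPc v
  have h1 : (hsInner (P * (W * P)) (P * (W * P))).re ≤ 1 * (hsInner (W * P) (W * P)).re :=
    re_hsInner_mul_self_le P (W * P) hPc'
  have h2 : (hsInner (W * P) (W * P)).re ≤ 1 * (hsInner W W).re := by
    rw [hsInner_mul_self_eq_conjTranspose, hP, hW]
    exact re_hsInner_mul_self_le P W hPc'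
  rw [Matrix.mul_assoc]
  linarith

/-- **Leak estimate.** For a Hermitian contraction `P` and Hermitian `W`, with `R = W - P W P`:
`‖R‖²_HS ≤ 4 ‖(1 - P) W‖²_HS` (`R = (1-P) W + P W (1-P)`, `‖P X‖_HS ≤ ‖X‖_HS`,
`‖W (1-P)‖_HS = ‖(1-P) W‖_HS`). [folklore] -/
theorem re_hsInner_leak_self_le [DecidableEq ι] {P W : Matrix ι ι ℂ} (hP : Pᴴ = P) (hW : Wᴴ = W)
    (hPc : ∀ v : ι → ℂ, (star (P *ᵥ v) ⬝ᵥ (P *ᵥ v)).re ≤ (star v ⬝ᵥ v).re) :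
    (hsInner (W - P * W * P) (W - P * W * P)).re ≤
      4 * (hsInner ((1 - P) * W) ((1 - P) * W)).re := by
  have hPc' : ∀ v : ι → ℂ, (star (P *ᵥ v) ⬝ᵥ (P *ᵥ v)).re ≤ 1 * (star v ⬝ᵥ v).re := fun v => by
    rw [one_mul]; exact hPc v
  have hsplit : W - P * W * P = (1 - P) * W + P * (W * (1 - P)) := by
    simp only [Matrix.sub_mul, Matrix.mul_sub, Matrix.one_mul, Matrix.mul_one, Matrix.mul_assoc]
    abel
  have h1P : (1 - P)ᴴ = 1 - P := by rw [conjTranspose_sub, conjTranspose_one, hP]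
  have ha : (hsInner (P * (W * (1 - P))) (P * (W * (1 - P)))).re ≤
      1 * (hsInner (W * (1 - P)) (W * (1 - P))).re := re_hsInner_mul_self_le P _ hPc'
  have hb : hsInner (W * (1 - P)) (W * (1 - P)) = hsInner ((1 - P) * W) ((1 - P) * W) := by
    rw [hsInner_mul_self_eq_conjTranspose, h1P, hW]
  rw [hsplit]
  refine (re_hsInner_add_self_le _ _).trans ?_
  rw [hb] at ha
  linarith


/-- **One sandwich term.** For Hermitian `W` with `‖W‖_HS = 1`, a Hermitian contraction `P`, and `D` with
the one-layer bounds `‖D v‖², ‖Dᴴ v‖² ≤ M ‖v‖²` and the floor-to-floor bounds `‖P D P v‖² ≤ t₁ ‖v‖²`,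
`‖(P D P)ᴴ v‖² ≤ t₂ ‖v‖²`: if `‖W - P W P‖²_HS ≤ r`, then for every `l > 0`
`Re ⟨W, D W Dᴴ⟩_HS ≤ (t₁ + t₂)/2 + M l + M l⁻¹ r + M r` (split `W = P W P + R`, the floor part by
`two_mul_re_hsInner_conj_le`, the three remainders by `two_mul_abs_re_hsInner_sandwich_le`). [folklore] -/
theorem re_hsInner_sandwich_le [DecidableEq ι] {W P : Matrix ι ι ℂ} (D : Matrix ι ι ℂ) (hW : Wᴴ = W)
    (hP : Pᴴ = P) (hPc : ∀ v : ι → ℂ, (star (P *ᵥ v) ⬝ᵥ (P *ᵥ v)).re ≤ (star v ⬝ᵥ v).re)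
    {M l r t₁ t₂ : ℝ} (hM : 0 ≤ M) (hl : 0 < l)
    (hD : ∀ v : ι → ℂ, (star (D *ᵥ v) ⬝ᵥ (D *ᵥ v)).re ≤ M * (star v ⬝ᵥ v).re)
    (hDh : ∀ v : ι → ℂ, (star (Dᴴ *ᵥ v) ⬝ᵥ (Dᴴ *ᵥ v)).re ≤ M * (star v ⬝ᵥ v).re)
    (ht₁ : ∀ v : ι → ℂ, (star ((P * D * P) *ᵥ v) ⬝ᵥ ((P * D * P) *ᵥ v)).re ≤ t₁ * (star v ⬝ᵥ v).re)
    (ht₂ : ∀ v : ι → ℂ, (star ((P * D * P)ᴴ *ᵥ v) ⬝ᵥ ((P * D * P)ᴴ *ᵥ v)).re ≤ t₂ * (star v ⬝ᵥ v).re)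
    (hWW : (hsInner W W).re = 1) (hr : (hsInner (W - P * W * P) (W - P * W * P)).re ≤ r) :
    (hsInner W (D * W * Dᴴ)).re ≤ (t₁ + t₂) / 2 + M * l + M * l⁻¹ * r + M * r := by
  set Y : Matrix ι ι ℂ := P * W * P with hY
  set R : Matrix ι ι ℂ := W - P * W * P with hR
  have hWYR : W = Y + R := by rw [hY, hR]; abel
  have hYY : (hsInner Y Y).re ≤ 1 := (re_hsInner_floor_self_le hP hW hPc).trans hWW.le
  have hRR : 0 ≤ (hsInner R R).re := hsInner_self_re_nonneg R
  have hYY0 : 0 ≤ (hsInner Y Y).re := hsInner_self_re_nonneg Y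
  -- the floor part
  have hmain : 2 * (hsInner Y (D * Y * Dᴴ)).re ≤ t₁ + t₂ := by
    have h := two_mul_re_hsInner_conj_le hW (P * D * P) ht₁ ht₂
    rw [hWW, mul_one, ← hsInner_floor_sandwich_eq hP hW D] at h
    exact h
  -- the three remainders
  have hc₁ := two_mul_abs_re_hsInner_sandwich_le Y R D hl hD hDh
  have hc₂ := two_mul_abs_re_hsInner_sandwich_le R Y D (inv_pos.2 hl) hD hDh
  have hc₃ := two_mul_abs_re_hsInner_sandwich_le R R D one_pos hD hDh
  rw [inv_inv] at hc₂
  simp only [inv_one, one_mul] at hc₃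
  -- `‖Y‖² ≤ 1`, `‖R‖² ≤ r`
  have hb₁ : M * (l * (hsInner Y Y).re + l⁻¹ * (hsInner R R).re) ≤ M * (l + l⁻¹ * r) := by
    refine mul_le_mul_of_nonneg_left ?_ hM
    have := mul_le_mul_of_nonneg_left hYY hl.le
    have := mul_le_mul_of_nonneg_left hr (inv_pos.2 hl).le
    linarith
  have hb₂ : M * (l⁻¹ * (hsInner R R).re + l * (hsInner Y Y).re) ≤ M * (l⁻¹ * r + l) := by
    refine mul_le_mul_of_nonneg_left ?_ hM
    have := mul_le_mul_of_nonneg_left hYY hl.le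
    have := mul_le_mul_of_nonneg_left hr (inv_pos.2 hl).le
    linarith
  have hb₃ : M * ((hsInner R R).re + (hsInner R R).re) ≤ M * (r + r) :=
    mul_le_mul_of_nonneg_left (by linarith) hM
  -- assemble
  have hexp : hsInner W (D * W * Dᴴ) = hsInner Y (D * Y * Dᴴ) + hsInner Y (D * R * Dᴴ) +
      hsInner R (D * Y * Dᴴ) + hsInner R (D * R * Dᴴ) := by
    conv_lhs => rw [hWYR]
    exact hsInner_sandwich_add_add Y R D
  rw [hexp]
  simp only [Complex.add_re]
  have a₁ := (le_abs_self (hsInner Y (D * R * Dᴴ)).re)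
  have a₂ := (le_abs_self (hsInner R (D * Y * Dᴴ)).re)
  have a₃ := (le_abs_self (hsInner R (D * R * Dᴴ)).re)
  nlinarith [hmain, hc₁, hc₂, hc₃, hb₁, hb₂, hb₃, a₁, a₂, a₃]

end HilbertSchmidt

section Window

variable {ι : Type*} [Fintype ι] [DecidableEq ι]

/-- **The Josephson coupling of a near-floor window state is carried by the floors.** `A` Hermitian, `D`
arbitrary; two disjoint blocks `P₁, P₂`; `W = Wᴴ` supported on pairs in a common block, packaged as the
unit two-layer vector `ψ_W (s,t) = W s t`; a Hermitian contraction `P` with the GAP in variance form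
`γ ‖(1 - P) v‖² ≤ Re ⟨v, A v⟩ - e₀ ‖v‖²` on block-supported `v` (`γ > 0`), the one-layer bounds
`‖D v‖², ‖Dᴴ v‖² ≤ M ‖v‖²`, and the floor-to-floor transfer bounds `‖P D P v‖² ≤ s₁ ‖v‖²`,
`‖P Dᴴ P v‖² ≤ s₂ ‖v‖²`.  If `Re ⟨ψ_W, (A ⊗ 1 + 1 ⊗ Aᵀ) ψ_W⟩ ≤ 2 e₀ + η`, then for every `l > 0`
`Re ⟨ψ_W, (D ⊗ D̄ + Dᴴ ⊗ D̄ᴴ) ψ_W⟩ ≤ s₁ + s₂ + 2 M l + (2 M l⁻¹ + 2 M) (2 η / γ)` (`D̄ = Dᴴᵀ`).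
Proof: the columns `w_t` of `W` are block-supported with `Σ_t (Re ⟨w_t, A w_t⟩ - e₀ ‖w_t‖²) ≤ η / 2`
(`re_star_vec_double_mulVec_vec`), so `γ ‖(1-P) W‖²_HS ≤ η/2` and `‖W - PWP‖²_HS ≤ 2η/γ`
(`re_hsInner_leak_self_le`); then `re_hsInner_sandwich_le` for `D` and for `Dᴴ`
(`⟨ψ_W, K ψ_W⟩ = ⟨W, D W Dᴴ⟩_HS + ⟨W, Dᴴ W D⟩_HS`).  First-order degenerate perturbation theory in
Lieb's `W`-matrix language; Koma–Tasaki, J. Stat. Phys. 76 (1994) 745; Lieb, PRL 62 (1989) 1201;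
Kato (1966) II §5. [folklore] -/
theorem re_coupling_le_floor_add_leak (A D W P : Matrix ι ι ℂ) (P₁ P₂ : ι → Prop)
    (good : ι × ι → Prop) (e₀ M γ η s₁ s₂ l : ℝ)
    (hW : Wᴴ = W) (hP : Pᴴ = P) (h12 : ∀ s, P₁ s → ¬ P₂ s)
    (hgood : ∀ s t, good (s, t) → (P₁ s ∧ P₁ t) ∨ (P₂ s ∧ P₂ t))
    (hWsupp : ∀ s t, ¬ good (s, t) → W s t = 0)
    (hM : 0 ≤ M) (hγ : 0 < γ) (hl : 0 < l)
    (hPc : ∀ v : ι → ℂ, (star (P *ᵥ v) ⬝ᵥ (P *ᵥ v)).re ≤ (star v ⬝ᵥ v).re)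
    (hgap₁ : ∀ v : ι → ℂ, (∀ s, ¬ P₁ s → v s = 0) →
      γ * (star ((1 - P) *ᵥ v) ⬝ᵥ ((1 - P) *ᵥ v)).re ≤
        (star v ⬝ᵥ A *ᵥ v).re - e₀ * (star v ⬝ᵥ v).re)
    (hgap₂ : ∀ v : ι → ℂ, (∀ s, ¬ P₂ s → v s = 0) →
      γ * (star ((1 - P) *ᵥ v) ⬝ᵥ ((1 - P) *ᵥ v)).re ≤
        (star v ⬝ᵥ A *ᵥ v).re - e₀ * (star v ⬝ᵥ v).re)
    (hD : ∀ v : ι → ℂ, (star (D *ᵥ v) ⬝ᵥ (D *ᵥ v)).re ≤ M * (star v ⬝ᵥ v).re)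
    (hDh : ∀ v : ι → ℂ, (star (Dᴴ *ᵥ v) ⬝ᵥ (Dᴴ *ᵥ v)).re ≤ M * (star v ⬝ᵥ v).re)
    (hs₁ : ∀ v : ι → ℂ, (star ((P * D * P) *ᵥ v) ⬝ᵥ ((P * D * P) *ᵥ v)).re ≤ s₁ * (star v ⬝ᵥ v).re)
    (hs₂ : ∀ v : ι → ℂ, (star ((P * Dᴴ * P) *ᵥ v) ⬝ᵥ ((P * Dᴴ * P) *ᵥ v)).re ≤ s₂ * (star v ⬝ᵥ v).re)
    (h1 : star (fun p : ι × ι => W p.1 p.2) ⬝ᵥ (fun p : ι × ι => W p.1 p.2) = 1)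
    (hH0 : (star (fun p : ι × ι => W p.1 p.2) ⬝ᵥ
        (A ⊗ₖ (1 : Matrix ι ι ℂ) + (1 : Matrix ι ι ℂ) ⊗ₖ Aᵀ) *ᵥ (fun p : ι × ι => W p.1 p.2)).re ≤
      2 * e₀ + η) :
    (star (fun p : ι × ι => W p.1 p.2) ⬝ᵥ
        (D ⊗ₖ Dᴴᵀ + Dᴴ ⊗ₖ Dᵀ) *ᵥ (fun p : ι × ι => W p.1 p.2)).re ≤
      s₁ + s₂ + 2 * M * l + (2 * M * l⁻¹ + 2 * M) * (2 * η / γ) := by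
  -- (a) every column is supported in one block (in `P₁` vacuously if it vanishes)
  have hcol : ∀ t, (∀ s, ¬ P₁ s → W s t = 0) ∨ (∀ s, ¬ P₂ s → W s t = 0) := by
    intro t
    have hz : ∀ s, ¬ good (s, t) → W s t = 0 := fun s hs => hWsupp s t hs
    by_cases ht1 : P₁ t
    · refine Or.inl fun s hs => hz s fun hg => ?_
      rcases hgood s t hg with ⟨hs', -⟩ | ⟨-, ht'⟩
      · exact hs hs'
      · exact h12 t ht1 ht'
    · by_cases ht2 : P₂ t
      · refine Or.inr fun s hs => hz s fun hg => ?_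
        rcases hgood s t hg with ⟨-, ht'⟩ | ⟨hs', -⟩
        · exact ht1 ht'
        · exact hs hs'
      · refine Or.inl fun s _ => hz s fun hg => ?_
        rcases hgood s t hg with ⟨-, ht'⟩ | ⟨-, ht'⟩
        · exact ht1 ht'
        · exact ht2 ht'
  -- (b) the column gaps and their sum
  have hgapcol : ∀ t, γ * (star ((1 - P) *ᵥ fun s => W s t) ⬝ᵥ ((1 - P) *ᵥ fun s => W s t)).re ≤
      (star (fun s => W s t) ⬝ᵥ A *ᵥ fun s => W s t).re -
        e₀ * (star (fun s => W s t) ⬝ᵥ fun s => W s t).re := by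
    intro t
    rcases hcol t with h | h
    · exact hgap₁ _ h
    · exact hgap₂ _ h
  have hp1 : ∑ t, (star (fun s => W s t) ⬝ᵥ fun s => W s t).re = 1 := by
    rw [← Complex.re_sum, ← star_vec_self_eq_sum_cols W, h1, Complex.one_re]
  have hexcs : ∑ t, ((star (fun s => W s t) ⬝ᵥ A *ᵥ fun s => W s t).re -
      e₀ * (star (fun s => W s t) ⬝ᵥ fun s => W s t).re) ≤ η / 2 := by
    rw [re_star_vec_double_mulVec_vec A hW] at hH0
    rw [Finset.sum_sub_distrib, ← Finset.mul_sum, hp1, mul_one]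
    linarith
  -- (c) the leak `‖(1 - P) W‖²_HS ≤ η / (2γ)` and `‖W - PWP‖²_HS ≤ 2η/γ`
  have hleak : γ * (hsInner ((1 - P) * W) ((1 - P) * W)).re ≤ η / 2 := by
    rw [hsInner_mul_self_eq_sum_cols, Complex.re_sum, Finset.mul_sum]
    exact (Finset.sum_le_sum fun t _ => hgapcol t).trans hexcs
  have hr : (hsInner (W - P * W * P) (W - P * W * P)).re ≤ 2 * η / γ := by
    refine (re_hsInner_leak_self_le hP hW hPc).trans ?_
    rw [le_div_iff₀ hγ]
    nlinarith [hleak, hsInner_self_re_nonneg ((1 - P) * W)]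
  -- (d) `‖W‖²_HS = 1`
  have hWW : (hsInner W W).re = 1 := by
    rw [← star_vec_dotProduct_vec, h1, Complex.one_re]
  -- (e) the two sandwich terms
  have hPDP : (P * D * P)ᴴ = P * Dᴴ * P := by
    rw [conjTranspose_mul, conjTranspose_mul, hP, ← Matrix.mul_assoc]
  have hPDhP : (P * Dᴴ * P)ᴴ = P * D * P := by
    rw [conjTranspose_mul, conjTranspose_mul, hP, conjTranspose_conjTranspose, ← Matrix.mul_assoc]
  have hs₂' : ∀ v : ι → ℂ, (star ((P * D * P)ᴴ *ᵥ v) ⬝ᵥ ((P * D * P)ᴴ *ᵥ v)).re ≤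
      s₂ * (star v ⬝ᵥ v).re := by
    rw [hPDP]; exact hs₂
  have hs₁' : ∀ v : ι → ℂ, (star ((P * Dᴴ * P)ᴴ *ᵥ v) ⬝ᵥ ((P * Dᴴ * P)ᴴ *ᵥ v)).re ≤
      s₁ * (star v ⬝ᵥ v).re := by
    rw [hPDhP]; exact hs₁
  have hDhh : ∀ v : ι → ℂ, (star (Dᴴᴴ *ᵥ v) ⬝ᵥ (Dᴴᴴ *ᵥ v)).re ≤ M * (star v ⬝ᵥ v).re := by
    rw [conjTranspose_conjTranspose]; exact hD
  have hT₁ := re_hsInner_sandwich_le D hW hP hPc hM hl hD hDh hs₁ hs₂' hWW hr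
  have hT₂ := re_hsInner_sandwich_le Dᴴ hW hP hPc hM hl hDh hDhh hs₂ hs₁' hWW hr
  rw [conjTranspose_conjTranspose] at hT₂
  rw [star_vec_coupling_mulVec_vec, Complex.add_re]
  have hsum : (s₁ + s₂) / 2 + M * l + M * l⁻¹ * (2 * η / γ) + M * (2 * η / γ) +
      ((s₂ + s₁) / 2 + M * l + M * l⁻¹ * (2 * η / γ) + M * (2 * η / γ)) =
      s₁ + s₂ + 2 * M * l + (2 * M * l⁻¹ + 2 * M) * (2 * η / γ) := by ring
  rw [← hsum]
  exact add_le_add hT₁ hT₂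

end Window

section Registered

/-- **Registered form** (sub-goal `floorCouplingEngine` of line `Sketch`, crux `JmInterchange`): the statement of
`re_coupling_le_floor_add_leak` as one closed proposition (Kronecker products spelled `Matrix.kroneckerMap`),
so that the ledger can match it by name and signature. Koma–Tasaki, J. Stat. Phys. 76 (1994) 745; Lieb, PRL 62
(1989) 1201. [folklore] -/
theorem floorCouplingEngine : ∀ {ι : Type} [Fintype ι] [DecidableEq ι] (A D W P : Matrix ι ι ℂ) (P₁ P₂ : ι → Prop) (good : ι × ι → Prop) (e₀ M γ η s₁ s₂ l : ℝ), Wᴴ = W → Pᴴ = P → (∀ s, P₁ s → ¬ P₂ s) → (∀ s t, good (s, t) → (P₁ s ∧ P₁ t) ∨ (P₂ s ∧ P₂ t)) → (∀ s t, ¬ good (s, t) → W s t = 0) → 0 ≤ M → 0 < γ → 0 < l → (∀ v : ι → ℂ, (star (P *ᵥ v) ⬝ᵥ (P *ᵥ v)).re ≤ (star v ⬝ᵥ v).re) → (∀ v : ι → ℂ, (∀ s, ¬ P₁ s → v s = 0) → γ * (star ((1 - P) *ᵥ v) ⬝ᵥ ((1 - P) *ᵥ v)).re ≤ (star v ⬝ᵥ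 A *ᵥ v).re - e₀ * (star v ⬝ᵥ v).re) → (∀ v : ι → ℂ, (∀ s, ¬ P₂ s → v s = 0) → γ * (star ((1 - P) *ᵥ v) ⬝ᵥ ((1 - P) *ᵥ v)).re ≤ (star v ⬝ᵥ A *ᵥ v).re - e₀ * (star v ⬝ᵥ v).re) → (∀ v : ι → ℂ, (star (D *ᵥ v) ⬝ᵥ (D *ᵥ v)).re ≤ M * (star v ⬝ᵥ v).re) → (∀ v : ι → ℂ, (star (Dᴴ *ᵥ v) ⬝ᵥ (Dᴴ *ᵥ v)).re ≤ M * (star v ⬝ᵥ v).re) → (∀ v : ι → ℂ, (star ((P * D * P) *ᵥ v) ⬝ᵥ ((P * D * P) *ᵥ v)).re ≤ s₁ * (star v ⬝ᵥ v).re) → (∀ v : ι → ℂ, (star ((P * Dᴴ * P) *ᵥ v) ⬝ᵥ ((P * Dᴴ * P) *ᵥ v)).re ≤ s₂ * (star v ⬝ᵥ v).re) → star (fun p : ι × ι => W p.1 p.2) ⬝ᵥ (fun p : ι × ι => W p.1 p.2) = 1 → (star (fun p : ι × ι => W p.1 p.2) ⬝ᵥ (Matrix.kroneckerMap (fun a b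 : ℂ => a * b) A (1 : Matrix ι ι ℂ) + Matrix.kroneckerMap (fun a b : ℂ => a * b) (1 : Matrix ι ι ℂ) Aᵀ) *ᵥ (fun p : ι × ι => W p.1 p.2)).re ≤ 2 * e₀ + η → (star (fun p : ι × ι => W p.1 p.2) ⬝ᵥ (Matrix.kroneckerMap (fun a b : ℂ => a * b) D Dᴴᵀ + Matrix.kroneckerMap (fun a b : ℂ => a * b) Dᴴ Dᵀ) *ᵥ (fun p : ι × ι => W p.1 p.2)).re ≤ s₁ + s₂ + 2 * M * l + (2 * M * l⁻¹ + 2 * M) * (2 * η / γ) := by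
  intro ι _ _ A D W P P₁ P₂ good e₀ M γ η s₁ s₂ l hW hP h12 hgood hWsupp hM hγ hl hPc hgap₁ hgap₂ hD hDh hs₁ hs₂
    h1 hH0
  exact re_coupling_le_floor_add_leak A D W P P₁ P₂ good e₀ M γ η s₁ s₂ l hW hP h12 hgood hWsupp hM hγ hl hPc
    hgap₁ hgap₂ hD hDh hs₁ hs₂ h1 hH0

end Registered

end Summit.HubbardSuperconductivity.HubbardSuperconductivity.Theorems.JosephsonMirror
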